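import Literature.Computability.AlgebraicComplexity.LampertMoshkovitzDetFourPartitionRank
import HarnessLib

/-!
# Lampert–Moshkovitz 2025, Theorem 2: the partition rank of `det_n` is at least `log₂ n + 1`
# — multilinear forms in the rows, the restriction device, Lemma 2, the induction, Corollary 4

Topic `Literature/Computability/AlgebraicComplexity`; companion of
`LampertMoshkovitzDetFourPartitionRank.lean` (Theorem 3, Corollary 4 upper half `prk(det₄) ≤ 3`, Theorem 1),
whose docstring records the gap closed by this pair of files: "the lower half `prk(det₄) ≥ 3` (Theorem 2,
`prk(det_n) ≥ ⌊log₂ n⌋ + 1`) is not formalised here".  Source: A. Lampert, G. Moshkovitz, *Slice rank and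
partition rank of the determinant*, ITCS 2026 (LIPIcs 90), arXiv:2509.06294 [LampertMoshkovitz2025]; read as the
held text `paper:arxiv-2509.06294`, page `p0007` (§3.1).  Everything in this file is PROVED (no named fact, no
`sorry`); it introduces two definitions with bodies (`IsRowMultilinear`, `rowLift`).

Verbatim (p0003 L17): "the partition rank [Naslund20] `prk(T)` is the least number of summands when we require
each of the factors to be multilinear."  (p0007 L34–36) "consider a partition rank decomposition of `det_n` of
minimal length `det_n = Σ_{i=1}^r Q_i R_i`, where for each `i`, `Q_i` and `R_i` are multilinear forms in disjoint
sets of variable vectors. Let `I_i ⊂ [n]` correspond to the subset of vector variables that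
`Q_i ∈ (𝔽ⁿ)^{|I_i|} → 𝔽` depends on (so `|I_i| = ord(Q_i)`, and `R_i` depends on `I_iᶜ := [n] ∖ I_i`)."
(p0007 L12–13) "**Lemma 2.** Let `Q⃗ : (𝔽ⁿ)^k → 𝔽^ℓ` be a `k`-linear map with `k + ℓ ≤ n`. Then there exist
linearly independent `v_1, …, v_k ∈ 𝔽ⁿ` such that `Q⃗(v_1, …, v_k) = 0`."  (p0007 L22–24) "If
`T : (𝔽ⁿ)^d → 𝔽` is a multilinear form, `k < d`, and `v_1, …, v_k ∈ 𝔽ⁿ` are fixed, then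
`T[v_1, …, v_k] : (𝔽ⁿ)^{d−k} → 𝔽` is the multilinear form obtained by fixing the first `k` vectors in `T`."

## What is formalised (part 1: vocabulary and Lemma 2)

* `IsRowMultilinear I F` — a function `F` of an `ι × ι` matrix over `K` that depends only on the rows indexed
  by `I` and is `K`-linear in each of them: the paper's "multilinear form in the vector variables `I`" (the
  vector variables being the rows).  API: `congr_rows`, `map_add`, `map_smul`, `const_mul`, `comp_mul_right`
  (the change of variables `Q ∘ A` of p0007 L48–52: `X ↦ X · M` acts on every row by `x ↦ x M`),
  `comp_rowLift` (restriction, below).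
* `rowLift p Y` — the restriction device `T[e_1, …, e_k]` (p0007 L22–24, L55–57): the `ι × ι` matrix whose
  rows at the indices satisfying `p` are the standard basis vectors and whose other rows are those of the
  matrix `Y` on `{i // ¬ p i}`, padded by zeros; `det_rowLift : det (rowLift p Y) = det Y`
  ("`det_{n−k} = det_n[e_1, …, e_k]`", p0007 L55–56), `rowLift_updateRow`, `rowLift_row_of_pos/_of_not`.
* `lemma2` — **Lemma 2** in the tree's coordinates, following the printed proof: the `k − 1` arbitrary
  independent vectors are the basis vectors `e_i`, `i ∈ I₀ ∖ {i₁}`; the last vector `x` is taken in the kernel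
  of the linear map `L(x) = Q⃗(e, …, e, x)` (`dim ker L ≥ n − ℓ ≥ k`, `LinearMap.finrank_range_add_finrank_ker`)
  outside `span{e_i : i ∈ I₀ ∖ {i₁}}` (dimension `≤ k − 1`), which is recorded as a non-zero coordinate
  `x_c`, `c ∉ I₀ ∖ {i₁}`; the conclusion is that every form of the family vanishes on each matrix with these
  rows on `I₀`.
* `det_changeOfBasis_ne_zero`, `single_vecMul_changeOfBasis` — the invertible matrix `M` with rows `e_{σ i}`
  (`σ` the transposition `(i₁ c)`) and `x` at `i₁`, realising the paper's "let `A ∈ GL_n(𝔽)` be a matrix with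
  `A e_i = v_i`" (p0007 L48–49) for the vectors of `lemma2`: `e_i M = e_i` on `I₀ ∖ {i₁}`, `e_{i₁} M = x`.

(p0007 L26–27, L72–73; p0003 L19–24) "**Theorem 2.** `prk(det_n) ≥ log(n) + 1`." … "For small values of `n`,
the bound `prk(det_n) ≥ log(n) + 1` in Theorem 2 implies `prk(det₂) = 2`, `prk(det₃) = 3`, and `prk(det₄) ≥ 3`."
… "**Theorem 3.** It is not true that `prk(det_n) = n`, or that `prk(det_n) = sr(det_n)`. Namely, `prk(det₄) = 3`
over any field."

## What is formalised (part 2: Theorem 2, Remark 2, Corollary 4)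

* `theorem2_card_le_two_pow` / `theorem2_two_mul_card_le` — **Theorem 2** in the numerical form
  `2 · |ι| ≤ 2 ^ |T|` for every partition rank decomposition `det A = Σ_{t : T} Q_t(A) · R_t(A)` of the
  determinant of `ι × ι` matrices over a field, `Q_t` multilinear in the rows `I_t` and `R_t` in the rows
  `I_tᶜ` (both non-empty); `theorem2` — the printed form `⌈log₂ |ι|⌉ + 1 ≤ |T|` (`Nat.clog`).  The proof is the
  printed induction (p0007 L28–62) with two bookkeeping deviations recorded at `theorem2_card_le_two_pow`: the
  fixed row set is chosen of minimal size among all sides `I_t`, `I_tᶜ` of size `≤ n/2` (no tie-breaking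
  convention needed), and the case `k + r > n` is closed by arithmetic instead of the Laplace upper bound.
* `remark2_det_two`, `remark2_det_three`, `remark2_det_four` — **Remark 2**: at least `2`, `3`, `3` terms for
  `det₂`, `det₃`, `det₄`.
* `corollary4` — **Corollary 4** `prk(det₄) = 3`: a length-`3` decomposition exists (Theorem 3 =
  `theorem3'` of the companion file, each `P_{ab}` being bilinear in the rows `a, b`:
  `isRowMultilinear_pairMinors`), and every decomposition has `≥ 3` terms.

Honest framing: a calibration source for rank-type laws on two-factor decompositions (the `ValiantsHypothesis`
lines `laplace_rigidity` / `component_rigidity` of crux 17819 cite Theorem 3 / Corollary 4); NOT load-bearing for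
any route; nothing here bears on `VP ≠ VNP` (NOT proved), and no summit statement is proved in this file.

[cite: LampertMoshkovitz2025, Lemma 2, Theorem 2, Remark 2, Corollary 4 (§3.1–3.2)]
-/

noncomputable section

namespace Literature.Computability.AlgebraicComplexity.LampertMoshkovitz

open Matrix Finset Module

/-! ### Theorem 2: `prk(det_n) ≥ log₂ n + 1` — multilinear forms in the rows -/

section RowMultilinear

variable {K : Type*} [CommRing K] {ι : Type*} [DecidableEq ι]

/-- `F : (ι × ι matrices) → K` is a **multilinear form in the row vectors indexed by `I`**: it depends
only on the rows `A i`, `i ∈ I`, and is `K`-linear in each of them separately (the paper's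
"`Q_i ∈ (𝔽ⁿ)^{|I_i|} → 𝔽` depends on the subset `I_i` of vector variables", p0007 L34–36; the determinant
itself is a multilinear form in all `n` rows). [cite: LampertMoshkovitz2025, §1 (p0003 L17) and §3.1 (p0007 L34–36)] -/
def IsRowMultilinear (I : Finset ι) (F : Matrix ι ι K → K) : Prop :=
  (∀ A B : Matrix ι ι K, (∀ i ∈ I, A i = B i) → F A = F B) ∧
  (∀ i ∈ I, ∀ (A : Matrix ι ι K) (x y : ι → K),
      F (A.updateRow i (x + y)) = F (A.updateRow i x) + F (A.updateRow i y)) ∧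
  (∀ i ∈ I, ∀ (A : Matrix ι ι K) (c : K) (x : ι → K),
      F (A.updateRow i (c • x)) = c * F (A.updateRow i x))

namespace IsRowMultilinear

variable {I : Finset ι} {F : Matrix ι ι K → K}

/-- A row-multilinear form on `I` only sees the rows in `I`. [cite: LampertMoshkovitz2025, §3.1 (p0007 L34–36)] -/
theorem congr_rows (hF : IsRowMultilinear I F) {A B : Matrix ι ι K} (h : ∀ i ∈ I, A i = B i) :
    F A = F B := hF.1 A B h

/-- Additivity in each row of `I`. [cite: LampertMoshkovitz2025, §3.1 (p0007 L34–36)] -/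
theorem map_add (hF : IsRowMultilinear I F) {i : ι} (hi : i ∈ I) (A : Matrix ι ι K) (x y : ι → K) :
    F (A.updateRow i (x + y)) = F (A.updateRow i x) + F (A.updateRow i y) := hF.2.1 i hi A x y

/-- Homogeneity in each row of `I`. [cite: LampertMoshkovitz2025, §3.1 (p0007 L34–36)] -/
theorem map_smul (hF : IsRowMultilinear I F) {i : ι} (hi : i ∈ I) (A : Matrix ι ι K) (c : K)
    (x : ι → K) : F (A.updateRow i (c • x)) = c * F (A.updateRow i x) := hF.2.2 i hi A c x

/-- Scaling a row-multilinear form by a constant. [cite: LampertMoshkovitz2025, §3.1] -/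
theorem const_mul (hF : IsRowMultilinear I F) (a : K) : IsRowMultilinear I (fun A => a * F A) := by
  refine ⟨fun A B h => ?_, fun i hi A x y => ?_, fun i hi A c x => ?_⟩
  · simp only [hF.congr_rows h]
  · simp only [hF.map_add hi, mul_add]
  · simp only [hF.map_smul hi]; ring

variable [Fintype ι]

omit [DecidableEq ι] in
/-- Row `i` of `X * M` is `(X i) ᵥ* M`. [folklore] -/
private theorem mul_row (X M : Matrix ι ι K) (i : ι) : (X * M) i = X i ᵥ* M := by
  funext j
  simp [Matrix.mul_apply, Matrix.vecMul, dotProduct]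

/-- `updateRow` commutes with right multiplication. [folklore] -/
private theorem updateRow_mul (X M : Matrix ι ι K) (i : ι) (x : ι → K) :
    X.updateRow i x * M = (X * M).updateRow i (x ᵥ* M) := by
  funext i' 
  by_cases h : i' = i
  · subst h
    rw [mul_row, Matrix.updateRow_self, Matrix.updateRow_self]
  · rw [mul_row, Matrix.updateRow_ne h, Matrix.updateRow_ne h, mul_row]

/-- A change of basis `x ↦ x M` on every row preserves row-multilinearity (the paper's
`Q_i ∘ A`). [cite: LampertMoshkovitz2025, §3.1 (p0007 L48–52)] -/
theorem comp_mul_right (hF : IsRowMultilinear I F) (M : Matrix ι ι K) :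
    IsRowMultilinear I (fun X => F (X * M)) := by
  refine ⟨fun A B h => hF.congr_rows fun i hi => ?_, fun i hi A x y => ?_, fun i hi A c x => ?_⟩
  · rw [mul_row, mul_row, h i hi]
  · simp only [updateRow_mul, Matrix.add_vecMul]
    exact hF.map_add hi _ _ _
  · simp only [updateRow_mul, Matrix.smul_vecMul]
    exact hF.map_smul hi _ _ _

end IsRowMultilinear

end RowMultilinear

section RowLift

variable {K : Type*} [CommRing K] {ι : Type*} [DecidableEq ι] (p : ι → Prop) [DecidablePred p]

/-- **Restriction device** `T[e_1, …, e_k]` of the paper (p0007 L22–24, L55–57): pad a square matrix on the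
index set `{i // ¬ p i}` to an `ι × ι` matrix whose rows at the indices satisfying `p` are the standard basis
vectors `e_i` and whose other rows are the given ones, extended by `0` on the columns satisfying `p`.  Its
determinant is the given determinant (`det_rowLift`); used with `p = (· ∈ I)` for a set `I` of fixed rows.
[cite: LampertMoshkovitz2025, §3.1 (p0007 L22–24, L55–57)] -/
def rowLift (Y : Matrix {i // ¬ p i} {i // ¬ p i} K) : Matrix ι ι K :=
  Matrix.of fun i j =>
    if hi : p i then (if j = i then 1 else 0) else if hj : p j then 0 else Y ⟨i, hi⟩ ⟨j, hj⟩

/-- The rows of `rowLift p Y` off `p`: the rows of `Y` padded by zeros. [cite: LampertMoshkovitz2025, §3.1] -/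
theorem rowLift_row_of_not (Y : Matrix {i // ¬ p i} {i // ¬ p i} K) {i : ι} (hi : ¬ p i) :
    rowLift p Y i = fun j => if hj : p j then 0 else Y ⟨i, hi⟩ ⟨j, hj⟩ := by
  funext j
  simp [rowLift, hi]

/-- The rows of `rowLift p Y` on `p`: standard basis vectors. [cite: LampertMoshkovitz2025, §3.1] -/
theorem rowLift_row_of_pos (Y : Matrix {i // ¬ p i} {i // ¬ p i} K) {i : ι} (hi : p i) :
    rowLift p Y i = Pi.single i 1 := by
  funext j
  simp [rowLift, hi, Pi.single_apply]

/-- `rowLift` commutes with updating a row (the update padded by zeros). [cite: LampertMoshkovitz2025, §3.1] -/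
theorem rowLift_updateRow (Y : Matrix {i // ¬ p i} {i // ¬ p i} K) (i : {i // ¬ p i})
    (y : {i // ¬ p i} → K) :
    rowLift p (Y.updateRow i y) =
      (rowLift p Y).updateRow (i : ι) (fun j => if hj : p j then 0 else y ⟨j, hj⟩) := by
  ext a j
  by_cases ha : a = (i : ι)
  · subst ha
    simp [rowLift, Matrix.updateRow_self, i.2]
  · rw [Matrix.updateRow_ne ha]
    by_cases hpa : p a
    · simp [rowLift, hpa]
    · have ha' : (⟨a, hpa⟩ : {i // ¬ p i}) ≠ i := fun h => ha (congrArg Subtype.val h)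
      simp [rowLift, hpa, Matrix.updateRow_ne ha']

variable [Fintype ι]

/-- `det (rowLift p Y) = det Y` (block lower-triangular with an identity block).
[cite: LampertMoshkovitz2025, §3.1 (p0007 L55–57: `det_{n-k} = det_n[e_1,…,e_k]`)] -/
theorem det_rowLift (Y : Matrix {i // ¬ p i} {i // ¬ p i} K) : (rowLift p Y).det = Y.det := by
  rw [Matrix.det_toBlock (rowLift p Y) p]
  have h12 : (rowLift p Y).toBlock p (fun j => ¬ p j) = 0 := by
    ext ⟨i, hi⟩ ⟨j, hj⟩
    have hji : j ≠ i := by rintro rfl; exact hj hi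
    simp [Matrix.toBlock_apply, rowLift, hi, hji]
  have h11 : (rowLift p Y).toBlock p p = 1 := by
    ext ⟨i, hi⟩ ⟨j, hj⟩
    simp only [Matrix.toBlock_apply, rowLift, hi, Matrix.of_apply, dif_pos, Matrix.one_apply,
      Subtype.mk.injEq]
    by_cases h : j = i
    · simp [h]
    · have h' : ¬ i = j := fun h'' => h h''.symm
      simp [h, h']
  have h22 : (rowLift p Y).toBlock (fun i => ¬ p i) (fun j => ¬ p j) = Y := by
    ext ⟨i, hi⟩ ⟨j, hj⟩
    simp [Matrix.toBlock_apply, rowLift, hi, hj]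
  rw [h12, h11, h22, Matrix.det_fromBlocks_zero₁₂, Matrix.det_one, one_mul]

end RowLift

section Restriction

variable {K : Type*} [CommRing K] {ι : Type*} [DecidableEq ι]

omit [DecidableEq ι] in
/-- Padding by zeros is additive. [folklore] -/
private theorem pad_add (p : ι → Prop) [DecidablePred p] (x y : {i // ¬ p i} → K) :
    (fun j => if hj : p j then (0 : K) else (x + y) ⟨j, hj⟩) =
      (fun j => if hj : p j then (0 : K) else x ⟨j, hj⟩) + fun j => if hj : p j then (0 : K) else y ⟨j, hj⟩ := by
  funext j
  by_cases hj : p j <;> simp [hj]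

omit [DecidableEq ι] in
/-- Padding by zeros is homogeneous. [folklore] -/
private theorem pad_smul (p : ι → Prop) [DecidablePred p] (c : K) (x : {i // ¬ p i} → K) :
    (fun j => if hj : p j then (0 : K) else (c • x) ⟨j, hj⟩) =
      c • fun j => if hj : p j then (0 : K) else x ⟨j, hj⟩ := by
  funext j
  by_cases hj : p j <;> simp [hj]

/-- **Restriction of a row-multilinear form** (the paper's `(Q_i R_i)[e_1, …, e_k]`, p0007 L55–57): fixing the
rows satisfying `p` to basis vectors and padding, a form multilinear in the rows `J` becomes a form in the
remaining rows, multilinear in those rows of `J` that are not fixed. [cite: LampertMoshkovitz2025, §3.1 (p0007 L22–24, L55–57)] -/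
theorem IsRowMultilinear.comp_rowLift {J : Finset ι} {F : Matrix ι ι K → K} (hF : IsRowMultilinear J F)
    (p : ι → Prop) [DecidablePred p] :
    IsRowMultilinear (J.subtype fun i => ¬ p i) (fun Y => F (rowLift p Y)) := by
  refine ⟨fun A B h => hF.congr_rows fun i hi => ?_, fun i hi A x y => ?_, fun i hi A c x => ?_⟩
  · by_cases hpi : p i
    · rw [rowLift_row_of_pos p A hpi, rowLift_row_of_pos p B hpi]
    · have hmem : (⟨i, hpi⟩ : {i // ¬ p i}) ∈ J.subtype fun i => ¬ p i := by simpa using hi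
      rw [rowLift_row_of_not p A hpi, rowLift_row_of_not p B hpi, h _ hmem]
  · have hi' : (i : ι) ∈ J := by simpa using hi
    simp only [rowLift_updateRow, pad_add]
    exact hF.map_add hi' _ _ _
  · have hi' : (i : ι) ∈ J := by simpa using hi
    simp only [rowLift_updateRow, pad_smul]
    exact hF.map_smul hi' _ _ _

end Restriction

/-! ### Lemma 2: a common zero of few multilinear maps on independent vectors -/

section Lemma2

variable {K : Type*} [Field K] {ι : Type*} [Fintype ι] [DecidableEq ι]

/-- **Lampert–Moshkovitz, Lemma 2.** "Let `Q⃗ : (𝔽ⁿ)^k → 𝔽^ℓ` be a `k`-linear map with `k + ℓ ≤ n`. Then there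
exist linearly independent `v_1, …, v_k ∈ 𝔽ⁿ` such that `Q⃗(v_1, …, v_k) = 0`."  Tree form, following the printed
proof (fix `k − 1` independent vectors, then pick `v_k` in the kernel of the remaining linear map
`L : 𝔽ⁿ → 𝔽^ℓ`, `dim ker L ≥ n − ℓ ≥ k`, outside their span): the `k`-linear map is a finite family
`G j`, `j : 𝒥`, of forms multilinear in the rows `I₀` (`k = |I₀|`, `ℓ = |𝒥|`) of an `ι × ι` matrix; the
independent vectors are the standard basis vectors `e_i`, `i ∈ I₀ ∖ {i₁}`, together with a vector `x` having a
non-zero coordinate `c` off `I₀ ∖ {i₁}` (so `x ∉ span{e_i}`), and every `G j` vanishes on each matrix with these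
rows. [cite: LampertMoshkovitz2025, Lemma 2 (p0007 L12–20)] -/
theorem lemma2 {𝒥 : Type*} [Fintype 𝒥] (I₀ : Finset ι) (G : 𝒥 → Matrix ι ι K → K)
    (hG : ∀ j, IsRowMultilinear I₀ (G j)) (hI₀ : I₀.Nonempty)
    (hcard : I₀.card + Fintype.card 𝒥 ≤ Fintype.card ι) :
    ∃ i₁ ∈ I₀, ∃ x : ι → K, (∃ c, c ∉ I₀.erase i₁ ∧ x c ≠ 0) ∧
      ∀ j (Z : Matrix ι ι K), Z i₁ = x → (∀ i ∈ I₀, i ≠ i₁ → Z i = Pi.single i 1) → G j Z = 0 := by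
  classical
  obtain ⟨i₁, hi₁⟩ := hI₀
  set J : Finset ι := I₀.erase i₁ with hJ
  -- the matrix with rows `e_i` on `J` (and `0` elsewhere)
  let Z₀ : Matrix ι ι K := fun i => if i ∈ J then Pi.single i 1 else 0
  -- the linear map `x ↦ (G j (Z₀ with row i₁ := x))_j`
  let L : (ι → K) →ₗ[K] (𝒥 → K) :=
    { toFun := fun x j => G j (Z₀.updateRow i₁ x)
      map_add' := fun x y => by
        funext j
        exact (hG j).map_add hi₁ Z₀ x y
      map_smul' := fun c x => by
        funext j
        simp only [Pi.smul_apply, smul_eq_mul, RingHom.id_apply]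
        exact (hG j).map_smul hi₁ Z₀ c x }
  -- dimension count: `dim ker L ≥ n - ℓ ≥ k > k - 1 ≥ dim span {e_i : i ∈ J}`
  have hrange : finrank K (LinearMap.range L) ≤ Fintype.card 𝒥 :=
    (Submodule.finrank_le _).trans (Module.finrank_fintype_fun_eq_card (R := K) (η := 𝒥)).le
  have hsum : finrank K (LinearMap.range L) + finrank K (LinearMap.ker L) = Fintype.card ι := by
    rw [LinearMap.finrank_range_add_finrank_ker, Module.finrank_fintype_fun_eq_card]
  let b : J → (ι → K) := fun i => Pi.single (i : ι) 1
  let E : Submodule K (ι → K) := Submodule.span K (Set.range b)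
  have hE : finrank K E ≤ J.card := by
    have h := finrank_range_le_card (R := K) b
    simpa [Set.finrank, E, Fintype.card_coe] using h
  have hJcard : J.card + 1 = I₀.card := by
    rw [hJ, Finset.card_erase_add_one hi₁]
  have hker : ¬ (LinearMap.ker L ≤ E) := by
    intro hle
    have h1 := Submodule.finrank_mono hle
    omega
  obtain ⟨x, hxker, hxE⟩ := SetLike.not_le_iff_exists.mp hker
  -- `x ∉ span {e_i : i ∈ J}` gives a non-zero coordinate off `J`
  have hc : ∃ c, c ∉ J ∧ x c ≠ 0 := by
    by_contra h
    push Not at h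
    apply hxE
    have hx : x = ∑ i ∈ J, x i • (Pi.single i (1 : K) : ι → K) := by
      funext d
      simp only [Finset.sum_apply, Pi.smul_apply, Pi.single_apply, smul_eq_mul, mul_ite, mul_one,
        mul_zero]
      by_cases hd : d ∈ J
      · rw [Finset.sum_eq_single d (fun i _ hid => if_neg (Ne.symm hid)) (fun hd' => (hd' hd).elim)]
        simp
      · rw [h d hd]
        exact (Finset.sum_eq_zero fun i hi => if_neg (by rintro rfl; exact hd hi)).symm
    rw [hx]
    exact Submodule.sum_mem _ fun i hi =>
      Submodule.smul_mem _ _ (Submodule.subset_span ⟨⟨i, hi⟩, rfl⟩)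
  refine ⟨i₁, hi₁, x, hc, fun j Z hZ₁ hZ => ?_⟩
  have hrows : G j Z = G j (Z₀.updateRow i₁ x) := by
    refine (hG j).congr_rows fun i hi => ?_
    by_cases h : i = i₁
    · subst h
      rw [hZ₁, Matrix.updateRow_self]
    · have hiJ : i ∈ J := by
        rw [hJ, Finset.mem_erase]
        exact ⟨h, hi⟩
      rw [Matrix.updateRow_ne h, hZ i hi h]
      simp [Z₀, hiJ]
  rw [hrows]
  exact congr_fun (LinearMap.mem_ker.mp hxker) j

/-- The change-of-basis matrix of the proof of Theorem 2: rows `e_{σ i}` (`i ≠ i₁`, `σ` the transposition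
`(i₁ c)`) and `x` (row `i₁`); it is invertible as soon as `x_c ≠ 0`. [cite: LampertMoshkovitz2025, §3.1 (p0007 L48–52)] -/
theorem det_changeOfBasis_ne_zero (i₁ c : ι) (x : ι → K) (hx : x c ≠ 0) :
    (Matrix.of fun i : ι => if i = i₁ then x else Pi.single (Equiv.swap i₁ c i) (1 : K)).det ≠ 0 := by
  set σ := Equiv.swap i₁ c with hσ
  set M : Matrix ι ι K := Matrix.of fun i : ι => if i = i₁ then x else Pi.single (σ i) (1 : K) with hM
  have hMi₁ : M i₁ = x := by
    funext j
    simp [hM]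
  have hMi : ∀ i, i ≠ i₁ → M i = Pi.single (σ i) 1 := fun i hi => by
    funext j
    simp [hM, hi]
  have hσc : σ c = i₁ := by simp [hσ]
  -- the rows are linearly independent
  have hli : LinearIndependent K M.row := by
    rw [Fintype.linearIndependent_iff]
    intro g hg
    have hgc : ∀ d, ∑ i, g i * M i d = 0 := fun d => by
      have := congr_fun hg d
      simpa [Finset.sum_apply, Pi.smul_apply, smul_eq_mul, Matrix.row] using this
    -- coordinate `c`: only row `i₁` contributes
    have h1 : g i₁ = 0 := by
      have h := hgc c
      rw [Finset.sum_eq_single i₁ (fun i _ hi => ?_) (fun h => (h (Finset.mem_univ _)).elim)] at h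
      · rw [hMi₁] at h
        exact (mul_eq_zero.mp h).resolve_right hx
      · rw [hMi i hi, Pi.single_apply]
        have : c ≠ σ i := by
          intro hc'
          apply hi
          have := congrArg σ hc'
          rw [hσc] at this
          rw [this]
          simp [hσ, Equiv.swap_apply_self]
        simp [this]
    intro i
    by_cases hi : i = i₁
    · rw [hi, h1]
    · have h := hgc (σ i)
      rw [Finset.sum_eq_single i (fun i' _ hi' => ?_) (fun h => (h (Finset.mem_univ _)).elim)] at h
      · rw [hMi i hi] at h
        simpa using h
      · by_cases hi'₁ : i' = i₁
        · rw [hi'₁, h1, zero_mul]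
        · rw [hMi i' hi'₁, Pi.single_apply]
          have : σ i ≠ σ i' := fun h => hi' (σ.injective h).symm
          simp [this]
  have hunit : IsUnit M := Matrix.linearIndependent_rows_iff_isUnit.mp hli
  exact ((Matrix.isUnit_iff_isUnit_det M).mp hunit).ne_zero

/-- The rows of the change-of-basis matrix on the fixed set: `e_i ᵥ* M = e_i` for `i ∈ I₀ ∖ {i₁}` when
`c ∉ I₀ ∖ {i₁}`, and `e_{i₁} ᵥ* M = x`. [cite: LampertMoshkovitz2025, §3.1 (p0007 L48–52)] -/
theorem single_vecMul_changeOfBasis (I₀ : Finset ι) (i₁ c : ι) (hc : c ∉ I₀.erase i₁) (x : ι → K)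
    (i : ι) (hi : i ∈ I₀) :
    Pi.single i (1 : K) ᵥ*
        (Matrix.of fun i : ι => if i = i₁ then x else Pi.single (Equiv.swap i₁ c i) (1 : K)) =
      if i = i₁ then x else Pi.single i 1 := by
  rw [Matrix.single_one_vecMul]
  funext j
  by_cases h : i = i₁
  · simp [Matrix.row, h]
  · have hic : i ≠ c := by
      rintro rfl
      exact hc (Finset.mem_erase.mpr ⟨h, hi⟩)
    simp [Matrix.row, h, Equiv.swap_apply_of_ne_of_ne h hic]

end Lemma2


/-! ## Part 2: Theorem 2, Remark 2, Corollary 4 -/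

universe u v

namespace IsRowMultilinear

variable {K : Type*} [CommRing K] {ι : Type*} [DecidableEq ι] {I : Finset ι} {F : Matrix ι ι K → K}

/-- Negating a row-multilinear form. [cite: LampertMoshkovitz2025, §3.1] -/
theorem neg (hF : IsRowMultilinear I F) : IsRowMultilinear I (fun A => - F A) := by
  refine ⟨fun A B h => ?_, fun i hi A x y => ?_, fun i hi A c x => ?_⟩
  · simp only [hF.congr_rows h]
  · simp only [hF.map_add hi, neg_add]
  · simp only [hF.map_smul hi]; ring

end IsRowMultilinear

/-! ### Theorem 2: the induction -/

section Theorem2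

variable {K : Type*} [Field K]

/-- `4 r ≤ 2 ^ r + 4`. [folklore] -/
private theorem four_mul_le_two_pow_add_four (r : ℕ) : 4 * r ≤ 2 ^ r + 4 := by
  induction r with
  | zero => simp
  | succ r ih =>
    rcases Nat.lt_or_ge r 2 with h | h
    · interval_cases r <;> norm_num
    · have h4 : 4 ≤ 2 ^ r :=
        calc (4 : ℕ) = 2 ^ 2 := by norm_num
          _ ≤ 2 ^ r := Nat.pow_le_pow_right (by norm_num) h
      calc 4 * (r + 1) = 4 * r + 4 := by ring
        _ ≤ 2 ^ r + 4 + 4 := by omega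
        _ ≤ 2 ^ r + 2 ^ r + 4 := by omega
        _ = 2 ^ (r + 1) + 4 := by ring

/-- **Theorem 2, induction form** (universe-explicit so that the induction hypothesis applies to the
restricted index types): for every partition-rank decomposition `det = Σ_{t : T} Q_t · R_t` of the determinant
of `ι × ι` matrices over a field — `Q_t` multilinear in the rows `I_t`, `R_t` in the rows `I_tᶜ`, both
non-empty — one has `2 · |ι| ≤ 2 ^ |T|`.  Printed proof (p0007 L28–62), with two bookkeeping deviations:
(i) the fixed row set `I₀` is taken of minimal size among ALL sides `I_t`, `I_tᶜ` of size `≤ n/2`, so that a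
side contained in `I₀` equals `I₀` without the paper's tie-breaking convention "`1 ∈ I_i` if `|I_i| = n/2`";
(ii) the case `k + r > n` is closed by the arithmetic `r ≥ n/2 + 1 ⇒ 2n ≤ 2^r` instead of the Laplace upper
bound `prk(det_{n−k}) ≤ n − k`.  The rest is verbatim: Lemma 2 kills every term one of whose sides is exactly
`I₀` after the change of basis `X ↦ X · M` (`det` changes by the unit `det M`), and restricting the rows `I₀`
to basis vectors (`rowLift`) leaves a partition-rank decomposition of `det` on the `n − k` remaining indices
with fewer terms, `n − k ≥ n/2`. [cite: LampertMoshkovitz2025, Theorem 2 (p0007 L26–62)] -/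
theorem theorem2_card_le_two_pow (n : ℕ) :
    ∀ {ι : Type u} [Fintype ι] [DecidableEq ι], Fintype.card ι = n →
    ∀ {T : Type v} [Fintype T] (I : T → Finset ι) (Q R : T → Matrix ι ι K → K),
      (∀ t, (I t).Nonempty ∧ ((I t)ᶜ).Nonempty) →
      (∀ t, IsRowMultilinear (I t) (Q t)) → (∀ t, IsRowMultilinear (I t)ᶜ (R t)) →
      (∀ A : Matrix ι ι K, A.det = ∑ t, Q t A * R t A) →
      2 * n ≤ 2 ^ Fintype.card T := by
  induction n using Nat.strong_induction_on with
  | _ n ih =>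
  intro ι _ _ hn T _ I Q R hI hQ hR hdet
  classical
  rcases Nat.eq_zero_or_pos n with rfl | hnpos
  · simp
  -- `T` is non-empty: `det 1 = 1 ≠ 0`
  have hTne : Nonempty T := by
    by_contra h
    haveI : IsEmpty T := not_nonempty_iff.mp h
    have h1 := hdet 1
    simp at h1
  have hT1 : 1 ≤ Fintype.card T := Fintype.card_pos_iff.mpr hTne
  -- the admissible sides: `I t` or `(I t)ᶜ`, of size `≤ n / 2`
  let 𝒮 : Finset (Finset ι) :=
    ((Finset.univ.image I) ∪ (Finset.univ.image fun t => (I t)ᶜ)).filter fun S => 2 * S.card ≤ n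
  have hmemQ : ∀ t, 2 * (I t).card ≤ n → I t ∈ 𝒮 := fun t ht =>
    Finset.mem_filter.mpr ⟨Finset.mem_union_left _ (Finset.mem_image_of_mem I (Finset.mem_univ t)), ht⟩
  have hmemR : ∀ t, 2 * ((I t)ᶜ).card ≤ n → (I t)ᶜ ∈ 𝒮 := fun t ht =>
    Finset.mem_filter.mpr
      ⟨Finset.mem_union_right _ (Finset.mem_image_of_mem (fun t => (I t)ᶜ) (Finset.mem_univ t)), ht⟩
  have h𝒮ne : 𝒮.Nonempty := by
    obtain ⟨t⟩ := hTne
    by_cases h : 2 * (I t).card ≤ n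
    · exact ⟨I t, hmemQ t h⟩
    · refine ⟨(I t)ᶜ, hmemR t ?_⟩
      have := Finset.card_compl (I t)
      omega
  obtain ⟨I₀, hI₀mem, hI₀min⟩ := 𝒮.exists_min_image Finset.card h𝒮ne
  have hI₀card : 2 * I₀.card ≤ n := (Finset.mem_filter.mp hI₀mem).2
  have hI₀side : ∃ t, I t = I₀ ∨ (I t)ᶜ = I₀ := by
    have h := (Finset.mem_filter.mp hI₀mem).1
    simp only [Finset.mem_union, Finset.mem_image, Finset.mem_univ, true_and] at h
    rcases h with ⟨t, ht⟩ | ⟨t, ht⟩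
    exacts [⟨t, Or.inl ht⟩, ⟨t, Or.inr ht⟩]
  have hI₀ne : I₀.Nonempty := by
    obtain ⟨t, h | h⟩ := hI₀side <;> rw [← h]
    exacts [(hI t).1, (hI t).2]
  -- a side contained in `I₀` equals `I₀`
  have hkeyQ : ∀ t, I t ⊆ I₀ → I t = I₀ := fun t hsub => by
    have hc : (I t).card ≤ I₀.card := Finset.card_le_card hsub
    exact Finset.eq_of_subset_of_card_le hsub (hI₀min _ (hmemQ t (by omega)))
  have hkeyR : ∀ t, (I t)ᶜ ⊆ I₀ → (I t)ᶜ = I₀ := fun t hsub => by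
    have hc : ((I t)ᶜ).card ≤ I₀.card := Finset.card_le_card hsub
    exact Finset.eq_of_subset_of_card_le hsub (hI₀min _ (hmemR t (by omega)))
  -- the terms killed by fixing the rows `I₀`
  let killed : T → Prop := fun t => I t = I₀ ∨ (I t)ᶜ = I₀
  set k := I₀.card with hk
  have hkpos : 0 < k := Finset.card_pos.mpr hI₀ne
  by_cases hcase : n < k + Fintype.card T
  · -- many terms: `r ≥ n − k + 1 ≥ n/2 + 1`, hence `2n ≤ 4r − 4 ≤ 2^r`
    have h4 := four_mul_le_two_pow_add_four (Fintype.card T)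
    omega
  · push Not at hcase
    -- Lemma 2 applied to the factors living exactly on `I₀`
    let G : {t : T // killed t} → Matrix ι ι K → K := fun t => if I t.1 = I₀ then Q t.1 else R t.1
    have hG : ∀ j, IsRowMultilinear I₀ (G j) := by
      rintro ⟨t, ht⟩
      by_cases h : I t = I₀
      · simp only [G, h, if_true]
        rw [← h]
        exact hQ t
      · have h' : (I t)ᶜ = I₀ := ht.resolve_left h
        simp only [G, h, if_false]
        rw [← h']
        exact hR t
    have hcardJ : I₀.card + Fintype.card {t : T // killed t} ≤ Fintype.card ι := by
      have := Fintype.card_subtype_le (fun t : T => killed t)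
      omega
    obtain ⟨i₁, hi₁, x, ⟨c, hc, hxc⟩, hvan⟩ := lemma2 I₀ G hG hI₀ne hcardJ
    -- the change of basis
    let M : Matrix ι ι K :=
      Matrix.of fun i : ι => if i = i₁ then x else Pi.single (Equiv.swap i₁ c i) (1 : K)
    have hMdet : M.det ≠ 0 := det_changeOfBasis_ne_zero i₁ c x hxc
    -- the restricted index types
    let ι' := {i // ¬ (i ∈ I₀)}
    have hι'card : Fintype.card ι' = n - k := by
      have h1 := Fintype.card_subtype_compl (fun i : ι => i ∈ I₀)
      have h2 : Fintype.card {i // i ∈ I₀} = I₀.card := Fintype.card_coe I₀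
      rw [h2, hn] at h1
      exact h1
    let T' := {t : T // ¬ killed t}
    have hT'card : Fintype.card T' < Fintype.card T := by
      obtain ⟨t₀, ht₀⟩ := hI₀side
      exact Fintype.card_subtype_lt (p := fun t => ¬ killed t) (x := t₀) (not_not_intro ht₀)
    -- the new decomposition, on `ι' × ι'` matrices
    let L : Matrix ι' ι' K → Matrix ι ι K := fun Y => rowLift (fun i => i ∈ I₀) Y * M
    let I' : T' → Finset ι' := fun t => (I t.1).subtype fun i => ¬ (i ∈ I₀)
    let Q' : T' → Matrix ι' ι' K → K := fun t Y => Q t.1 (L Y)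
    let R' : T' → Matrix ι' ι' K → K := fun t Y => (M.det)⁻¹ * R t.1 (L Y)
    have hI' : ∀ t : T', (I' t).Nonempty ∧ ((I' t)ᶜ).Nonempty := by
      rintro ⟨t, ht⟩
      have h1 : ¬ (I t ⊆ I₀) := fun h => ht (Or.inl (hkeyQ t h))
      have h2 : ¬ ((I t)ᶜ ⊆ I₀) := fun h => ht (Or.inr (hkeyR t h))
      rw [Finset.not_subset] at h1 h2
      obtain ⟨i, hi, hi₀⟩ := h1
      obtain ⟨i', hi', hi'₀⟩ := h2
      refine ⟨⟨⟨i, hi₀⟩, by simpa [I', ι'] using hi⟩, ⟨⟨i', hi'₀⟩, ?_⟩⟩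
      have hi'' : i' ∉ I t := Finset.mem_compl.mp hi'
      simpa [I', ι'] using hi''
    have hcomplI' : ∀ t : T', (I' t)ᶜ = ((I t.1)ᶜ).subtype fun i => ¬ (i ∈ I₀) := by
      intro t
      ext i
      simp [I', ι']
    have hQ' : ∀ t, IsRowMultilinear (I' t) (Q' t) := fun t =>
      ((hQ t.1).comp_mul_right M).comp_rowLift fun i => i ∈ I₀
    have hR' : ∀ t, IsRowMultilinear (I' t)ᶜ (R' t) := fun t => by
      rw [hcomplI']
      exact (((hR t.1).comp_mul_right M).const_mul (M.det)⁻¹).comp_rowLift fun i => i ∈ I₀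
    -- the rows of `L Y` on `I₀` are the vectors of Lemma 2, so the killed terms vanish
    have hLrow : ∀ (Y : Matrix ι' ι' K) (i : ι), i ∈ I₀ →
        L Y i = if i = i₁ then x else Pi.single i 1 := by
      intro Y i hi
      show (rowLift (fun i => i ∈ I₀) Y * M) i = _
      rw [IsRowMultilinear.mul_row, rowLift_row_of_pos (fun i => i ∈ I₀) Y hi]
      exact single_vecMul_changeOfBasis I₀ i₁ c hc x i hi
    have hvanish : ∀ t : T, killed t → ∀ Y, Q t (L Y) * R t (L Y) = 0 := by
      intro t ht Y
      have hrow₁ : L Y i₁ = x := by rw [hLrow Y i₁ hi₁, if_pos rfl]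
      have hrow : ∀ i ∈ I₀, i ≠ i₁ → L Y i = Pi.single i 1 := fun i hi hne => by
        rw [hLrow Y i hi, if_neg hne]
      have h0 := hvan ⟨t, ht⟩ (L Y) hrow₁ hrow
      by_cases h : I t = I₀
      · simp only [G, h, if_true] at h0
        rw [h0, zero_mul]
      · simp only [G, h, if_false] at h0
        rw [h0, mul_zero]
    have hdet' : ∀ Y : Matrix ι' ι' K, Y.det = ∑ t : T', Q' t Y * R' t Y := by
      intro Y
      have h1 : (L Y).det = Y.det * M.det := by
        show (rowLift (fun i => i ∈ I₀) Y * M).det = _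
        rw [Matrix.det_mul, det_rowLift]
      have h2 : (L Y).det = ∑ t, Q t (L Y) * R t (L Y) := hdet (L Y)
      have h3 : ∑ t, Q t (L Y) * R t (L Y) = ∑ t : T', Q t.1 (L Y) * R t.1 (L Y) := by
        rw [← Finset.sum_filter_of_ne (s := Finset.univ) (p := fun t => ¬ killed t)
          (f := fun t => Q t (L Y) * R t (L Y)) (fun t _ hne hk => hne (hvanish t hk Y))]
        exact Finset.sum_subtype _ (fun t => by simp) _
      have hY : Y.det = (L Y).det * (M.det)⁻¹ := by
        rw [h1, mul_inv_cancel_right₀ hMdet]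
      rw [hY, h2, h3, Finset.sum_mul]
      refine Finset.sum_congr rfl fun t _ => ?_
      simp only [Q', R']
      ring
    -- induction hypothesis on the `n - k` remaining rows
    have hlt : n - k < n := by omega
    have hIH := ih (n - k) hlt hι'card I' Q' R' hI' hQ' hR' hdet'
    have hpow : 2 ^ Fintype.card T' ≤ 2 ^ (Fintype.card T - 1) :=
      Nat.pow_le_pow_right (by norm_num) (by omega)
    have h2pow : 2 ^ Fintype.card T = 2 * 2 ^ (Fintype.card T - 1) := by
      rw [← pow_succ']
      congr 1
      omega
    omega

end Theorem2

/-! ### Theorem 2 as printed, Remark 2, and Corollary 4 -/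

section Statements

variable {K : Type*} [Field K] {ι : Type*} [Fintype ι] [DecidableEq ι]

/-- **Lampert–Moshkovitz, Theorem 2 (numerical form `2n ≤ 2^r`).**  If `det` of `ι × ι` matrices over a field
is written as `Σ_{t : T} Q_t · R_t` with `Q_t` multilinear in the rows `I_t` and `R_t` multilinear in the
complementary rows `I_tᶜ`, both non-empty (a partition rank decomposition of `det_n` in the rows, of length
`|T|`), then `2 · |ι| ≤ 2 ^ |T|`. [cite: LampertMoshkovitz2025, Theorem 2 (p0007 L26–62)] -/
theorem theorem2_two_mul_card_le {T : Type*} [Fintype T] (I : T → Finset ι)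
    (Q R : T → Matrix ι ι K → K) (hI : ∀ t, (I t).Nonempty ∧ ((I t)ᶜ).Nonempty)
    (hQ : ∀ t, IsRowMultilinear (I t) (Q t)) (hR : ∀ t, IsRowMultilinear (I t)ᶜ (R t))
    (hdet : ∀ A : Matrix ι ι K, A.det = ∑ t, Q t A * R t A) :
    2 * Fintype.card ι ≤ 2 ^ Fintype.card T :=
  theorem2_card_le_two_pow (K := K) (Fintype.card ι) rfl I Q R hI hQ hR hdet

/-- **Lampert–Moshkovitz, Theorem 2.** "For every `n ≥ 2`, `prk(det_n) ≥ log₂(n) + 1`": every partition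
rank decomposition of the determinant of `ι × ι` matrices (`|ι| ≥ 1`) in the rows has at least
`⌈log₂ |ι|⌉ + 1` terms. [cite: LampertMoshkovitz2025, Theorem 2 (p0003 L19–20, p0007 L26–62)] -/
theorem theorem2 {T : Type*} [Fintype T] (hι : 0 < Fintype.card ι) (I : T → Finset ι)
    (Q R : T → Matrix ι ι K → K) (hI : ∀ t, (I t).Nonempty ∧ ((I t)ᶜ).Nonempty)
    (hQ : ∀ t, IsRowMultilinear (I t) (Q t)) (hR : ∀ t, IsRowMultilinear (I t)ᶜ (R t))
    (hdet : ∀ A : Matrix ι ι K, A.det = ∑ t, Q t A * R t A) :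
    Nat.clog 2 (Fintype.card ι) + 1 ≤ Fintype.card T := by
  have h := theorem2_two_mul_card_le I Q R hI hQ hR hdet
  have hT : 1 ≤ Fintype.card T := by
    by_contra h0
    push Not at h0
    have : Fintype.card T = 0 := by omega
    rw [this, pow_zero] at h
    omega
  have h' : Fintype.card ι ≤ 2 ^ (Fintype.card T - 1) := by
    have : 2 ^ Fintype.card T = 2 * 2 ^ (Fintype.card T - 1) := by
      rw [← pow_succ']
      congr 1
      omega
    rw [this] at h
    omega
  have := Nat.clog_le_of_le_pow h'
  omega

/-- From `2n ≤ 2^r` and `2^m < 2n`, `m + 1 ≤ r`. [folklore] -/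
private theorem succ_le_of_two_pow_lt_two_mul {n r m : ℕ} (h : 2 * n ≤ 2 ^ r) (hm : 2 ^ m < 2 * n) :
    m + 1 ≤ r := by
  by_contra hlt
  push Not at hlt
  have : 2 ^ r ≤ 2 ^ m := Nat.pow_le_pow_right (by norm_num) (by omega)
  omega

/-- **Remark 2** (p0007 L72–73), `n = 2`: "`prk(det₂) = 2`" — the lower bound: every partition rank
decomposition of `det₂` in the rows has at least `2` terms. [cite: LampertMoshkovitz2025, Remark 2 (p0007 L72–73)] -/
theorem remark2_det_two {T : Type*} [Fintype T] (I : T → Finset (Fin 2))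
    (Q R : T → Matrix (Fin 2) (Fin 2) K → K) (hI : ∀ t, (I t).Nonempty ∧ ((I t)ᶜ).Nonempty)
    (hQ : ∀ t, IsRowMultilinear (I t) (Q t)) (hR : ∀ t, IsRowMultilinear (I t)ᶜ (R t))
    (hdet : ∀ A, A.det = ∑ t, Q t A * R t A) : 2 ≤ Fintype.card T := by
  have h := theorem2_two_mul_card_le I Q R hI hQ hR hdet
  rw [Fintype.card_fin] at h
  exact succ_le_of_two_pow_lt_two_mul h (by norm_num)

/-- **Remark 2** (p0007 L72–73), `n = 3`: "`prk(det₃) = 3`" — the lower bound: every partition rank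
decomposition of `det₃` in the rows has at least `3` terms. [cite: LampertMoshkovitz2025, Remark 2 (p0007 L72–73)] -/
theorem remark2_det_three {T : Type*} [Fintype T] (I : T → Finset (Fin 3))
    (Q R : T → Matrix (Fin 3) (Fin 3) K → K) (hI : ∀ t, (I t).Nonempty ∧ ((I t)ᶜ).Nonempty)
    (hQ : ∀ t, IsRowMultilinear (I t) (Q t)) (hR : ∀ t, IsRowMultilinear (I t)ᶜ (R t))
    (hdet : ∀ A, A.det = ∑ t, Q t A * R t A) : 3 ≤ Fintype.card T := by
  have h := theorem2_two_mul_card_le I Q R hI hQ hR hdet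
  rw [Fintype.card_fin] at h
  exact succ_le_of_two_pow_lt_two_mul h (by norm_num)

/-- **Remark 2** (p0007 L72–73), `n = 4`: "`prk(det₄) ≥ 3`": every partition rank decomposition of `det₄`
in the rows has at least `3` terms (the lower half of Corollary 4). [cite: LampertMoshkovitz2025, Remark 2 (p0007 L72–73)] -/
theorem remark2_det_four {T : Type*} [Fintype T] (I : T → Finset (Fin 4))
    (Q R : T → Matrix (Fin 4) (Fin 4) K → K) (hI : ∀ t, (I t).Nonempty ∧ ((I t)ᶜ).Nonempty)
    (hQ : ∀ t, IsRowMultilinear (I t) (Q t)) (hR : ∀ t, IsRowMultilinear (I t)ᶜ (R t))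
    (hdet : ∀ A, A.det = ∑ t, Q t A * R t A) : 3 ≤ Fintype.card T := by
  have h := theorem2_two_mul_card_le I Q R hI hQ hR hdet
  rw [Fintype.card_fin] at h
  exact succ_le_of_two_pow_lt_two_mul h (by norm_num)

/-- The sum of the six `2 × 2` minors on the rows `a ≠ b` of a `4 × 4` matrix (Theorem 3's `P_{ab}`) is a
bilinear form in the rows `a, b`. [cite: LampertMoshkovitz2025, Theorem 3 / Corollary 4 (p0007 L80–88, p0008 L83–84)] -/
theorem isRowMultilinear_pairMinors {R₀ : Type*} [CommRing R₀] (a b : Fin 4) (hab : a ≠ b) :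
    IsRowMultilinear ({a, b} : Finset (Fin 4))
      (fun A : Matrix (Fin 4) (Fin 4) R₀ =>
        ∑ i : Fin 4, ∑ j : Fin 4, if i < j then (A.submatrix ![a, b] ![i, j]).det else 0) := by
  refine ⟨fun A B h => ?_, fun i hi A x y => ?_, fun i hi A c x => ?_⟩
  · have ha : A a = B a := h a (by simp)
    have hb : A b = B b := h b (by simp)
    refine Finset.sum_congr rfl fun i _ => Finset.sum_congr rfl fun j _ => ?_
    split_ifs
    · simp [Matrix.det_fin_two, ha, hb]
    · rfl
  · simp only [Finset.mem_insert, Finset.mem_singleton] at hi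
    rw [← Finset.sum_add_distrib]
    refine Finset.sum_congr rfl fun i' _ => ?_
    rw [← Finset.sum_add_distrib]
    refine Finset.sum_congr rfl fun j' _ => ?_
    split_ifs
    · rcases hi with rfl | rfl
      · simp [Matrix.det_fin_two, Matrix.updateRow_self, Matrix.updateRow_ne hab.symm]
        ring
      · simp [Matrix.det_fin_two, Matrix.updateRow_self, Matrix.updateRow_ne hab]
        ring
    · simp
  · simp only [Finset.mem_insert, Finset.mem_singleton] at hi
    rw [Finset.mul_sum]
    refine Finset.sum_congr rfl fun i' _ => ?_
    rw [Finset.mul_sum]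
    refine Finset.sum_congr rfl fun j' _ => ?_
    split_ifs
    · rcases hi with rfl | rfl
      · simp [Matrix.det_fin_two, Matrix.updateRow_self, Matrix.updateRow_ne hab.symm]
        ring
      · simp [Matrix.det_fin_two, Matrix.updateRow_self, Matrix.updateRow_ne hab]
        ring
    · simp

/-- **Lampert–Moshkovitz, Corollary 4.** "Over any field, `prk(det₄) = 3`": (upper) the determinant of
`4 × 4` matrices has a partition rank decomposition in the rows of length `3` — Theorem 3's
`det A = P₀₁ P₂₃ − P₀₂ P₁₃ + P₀₃ P₁₂` read with `P_{ab}` bilinear in the rows `{a, b}` (the tree's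
`theorem3'`); (lower) every such decomposition has at least `3` terms (Theorem 2 / Remark 2).
[cite: LampertMoshkovitz2025, Corollary 4 (p0003 L22–24, p0008 L81–84)] -/
theorem corollary4 :
    (∃ (I : Fin 3 → Finset (Fin 4)) (Q R : Fin 3 → Matrix (Fin 4) (Fin 4) K → K),
        (∀ t, (I t).Nonempty ∧ ((I t)ᶜ).Nonempty) ∧ (∀ t, IsRowMultilinear (I t) (Q t)) ∧
        (∀ t, IsRowMultilinear (I t)ᶜ (R t)) ∧ ∀ A, A.det = ∑ t, Q t A * R t A) ∧
    (∀ {T : Type*} [Fintype T] (I : T → Finset (Fin 4)) (Q R : T → Matrix (Fin 4) (Fin 4) K → K),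
        (∀ t, (I t).Nonempty ∧ ((I t)ᶜ).Nonempty) → (∀ t, IsRowMultilinear (I t) (Q t)) →
        (∀ t, IsRowMultilinear (I t)ᶜ (R t)) → (∀ A, A.det = ∑ t, Q t A * R t A) →
        3 ≤ Fintype.card T) := by
  refine ⟨?_, fun I Q R hI hQ hR hdet => remark2_det_four I Q R hI hQ hR hdet⟩
  -- Theorem 3's column sums `P_{ab}`
  let P : Fin 4 → Fin 4 → Matrix (Fin 4) (Fin 4) K → K := fun a b A =>
    ∑ i : Fin 4, ∑ j : Fin 4, if i < j then (A.submatrix ![a, b] ![i, j]).det else 0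
  refine ⟨![{0, 1}, {0, 2}, {0, 3}], ![P 0 1, fun A => -P 0 2 A, P 0 3], ![P 2 3, P 1 3, P 1 2],
    ?_, ?_, ?_, ?_⟩
  · intro t
    fin_cases t <;> decide
  · intro t
    fin_cases t
    · exact isRowMultilinear_pairMinors 0 1 (by decide)
    · exact (isRowMultilinear_pairMinors (R₀ := K) 0 2 (by decide)).neg
    · exact isRowMultilinear_pairMinors 0 3 (by decide)
  · intro t
    fin_cases t
    · show IsRowMultilinear (({0, 1} : Finset (Fin 4))ᶜ) (P 2 3)
      have h : (({0, 1} : Finset (Fin 4))ᶜ) = {2, 3} := by decide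
      rw [h]
      exact isRowMultilinear_pairMinors 2 3 (by decide)
    · show IsRowMultilinear (({0, 2} : Finset (Fin 4))ᶜ) (P 1 3)
      have h : (({0, 2} : Finset (Fin 4))ᶜ) = {1, 3} := by decide
      rw [h]
      exact isRowMultilinear_pairMinors 1 3 (by decide)
    · show IsRowMultilinear (({0, 3} : Finset (Fin 4))ᶜ) (P 1 2)
      have h : (({0, 3} : Finset (Fin 4))ᶜ) = {1, 2} := by decide
      rw [h]
      exact isRowMultilinear_pairMinors 1 2 (by decide)
  · intro A
    rw [theorem3' A, Fin.sum_univ_three]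
    simp only [P, Matrix.cons_val_zero, Matrix.cons_val_one, Matrix.cons_val_two, Matrix.head_cons,
      Matrix.tail_cons]
    ring

end Statements


end Literature.Computability.AlgebraicComplexity.LampertMoshkovitz

end
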